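import Literature.NumberTheory.EllipticCurves.Tian2014.CongruentNumberTwistTransfer
import HarnessLib

/-!
# Tian 2014 §2 AS PRINTED — the CM-point system `(H(i), 𝒜, σ_t, σ_{1+ϖ}, conj, z_t)` for `n ≡ 3 (mod 4)`:
# Def. 2.7, Thm. 2.8 (1)–(3), (4.8) = journal (4.9), the Galois facts — DISPLAYS; the Heegner point `y_{2n,φ}`
# ((4.5) = journal (4.6)); the transfer `E_{2n}(ℚ) → E(H)`; the two targets of the Monsky route (M-y, GZ)

Cell `bsd-monsky` (typer seat; `run/shared/lean/pub/bsd-monsky/lean/PLAN.md` tier 1). Pattern: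
`TianYuanZhang2017/GenusPointDescentDisplays.lean` (`structure` of the paper's OBJECTS + one `def … : Prop` per
printed statement + ONE named fact «such data exist»). HONEST FRAMING: nothing asserted (no `_holds`), nothing
booked; every `def … : Prop` is a displayed printed sentence with its locator (arXiv:1210.8231 `pNNNN LMM` =
page:line of the materialised text; journal = Camb. J. Math. 2 (2014), page = arXiv page + 116 in §2). The ONE named
fact is `thm28_cmPointSystem` (Tian Thm. 2.8 = Monsky Thm. 2.11 (1)–(3) through `φ : C ≅ E`, the licence of
Monsky p. 51). The Gross–Zagier index relation (`GrossZagierScriptL`) is displayed as a PREDICATE only; the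
corresponding named fact (TYZ Thm. 3.3 at `(2n, 1)` + Tian `P_{χ₀}(f) = 4y` + the (B4) assembly) is NOT filed here.

## Source (verbatim, arXiv:1210.8231)

* Def. 2.7 (p0011 L25–L36 = J132): "Let `n ≡ 3 mod 4` be a positive integer and `K = ℚ(√−2n)`. Let `P ∈ X₀(32)` be
  the image of `(2 + i√2n)/8` under the complex uniformization and define a CM point `z := f(P) + (1 + √2, 2 + √2)
  ∈ E(K^ab)`. For any `t ∈ K̂ˣ` satisfying `σ_t` fixing `i`, define `z_t := z^{σ_t}`."
* Thm. 2.8 (p0011 L37–L44 = J132): "Assume that `n ≡ 3 mod 4` is a positive integer. Then, for each `t ∈ K̂ˣ` with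
  `σ_t` fixing `i`, we have (1) the point `z_t ∈ E(H(i))` and the involution `σ_{1+ϖ}` of `Gal(H(i)/H)` maps
  `z_t` to `z_t + (0, 0)`; (2) the complex conjugation of `z_t`, denoted by `z̄_t`, is equal to
  `−z_{t⁻¹} + (1, 0)`; (3) let `ϖ′ = ϖ(1 + ϖ) ∈ K₂ˣ` (so that `σ_{ϖ′}` fixes `i`), then `z_{ϖ′t} − z_t = (1, 0)`
  or `(−1, 0)` according to `n ≡ 7 mod 8` or `3 mod 8`."
* §4.2 (p0022 L47–L60): "`n = p₀p₁⋯p_k` … The genus field of `K = ℚ(√−2n)` is `H₀ = K(√−p₀, √p₁, ⋯, √p_k)`.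
  Thus `√2 ∈ H₀` but `i ∉ H`. We identify the ideal class group `𝒜` of `K` with the subquotient of `K̂ˣ`
  corresponding to `Gal(H(i)/K(i))`. … `ϖ′ = ϖ(1 + ϖ) ∈ K₂ˣ` which is also a uniformizer and `σ_{ϖ′}` fixes `i`."
* (4.5) = journal (4.6) (p0022 L84–L96): "For any complete representatives `φ ⊂ 𝒜` of `𝒜/[ϖ′]`, we define
  `y_{d,φ} = Σ_{t∈φ} χ(t) z_t`. The point `y_{d,φ}` is independent of `φ` up to `E[2]` by Theorem 2.8 (3). …
  Note that `4y_d = P_χ(f)`." With `d = 2n`: `χ = χ_{2n}` is TRIVIAL (L76–L78: "non-trivial when `d ≠ 2n`").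
* Prop. 4.6, proof (p0023 L26–L28): "Note that the Galois group `Gal(H(i)/ℚ)` is generated by `Gal(H(i)/K(i))`,
  the complex conjugation, and the operator `σ_{1+ϖ}`." (4.8) = journal (4.9) (p0023 L46–L50): "Any `σ_s ∈
  Gal(H(i)/K(i))` maps `y_{m,φ}` to `Σ_φ χ(t) z_{st} = χ(s) y_{m,[s]φ}`" — i.e. `z_t^{σ_s} = z_{st}`.
* Monsky 1990, p. 51: "all we shall use are the properties of the `P_𝒜` given in Theorems 2.8 and 2.11"; Thm. 2.11
  (1)–(3) is the same system through Monsky's `φ : C ≅ E` (`(−1,1), (1,−1), (−1,−1) ↦ (1,0), (−1,0), (0,0)`, p. 62)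
  and `t ↔ 𝒜⁻¹` (`p2/lit/L2-38-RT15c-SECOND-READ-lit2.md` C5) — the one named fact carries both sources.

## Transcription (tree dictionary)
* `E : y² = x³ − x` is the tree's `congruentNumberCurve 1`; `E(H)` its `H`-points (`EPoint H`); the `2`-torsion
  points `(0,0)`, `(1,0)`, `(−1,0)` are `ptZero`, `ptOne`, `ptNegOne` (`Tian2014/CongruentNumberTwistTransfer.lean`).
* `𝒜 = Cl(K)`, `K = ℚ(√−2n)`: Mathlib's `ClassGroup (𝓞 (GenusField (2n)))` (`GenusField d = ℚ[X]/(X² + d)`).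
* `H(i)`: an abstract number field `H`, Galois over `ℚ`, with `i`, `√−2n ∈ H`; "`σ_t`" = a group homomorphism
  `art : 𝒜 →* Aut(H/ℚ)` (the Artin map onto `Gal(H(i)/K(i))`); `σ_{1+ϖ}` = `tau`; complex conjugation = `conj`
  (an automorphism of `H` with the printed effects: moves `i` and `√−2n`); `[ϖ′] ∈ 𝒜` = `piPrime`.
* "`E(ℚ(√−2n))⁻ ≅ E_{2n}(ℚ)`": `transferE (2n) θ : E_{2n}(ℚ) →+ E(H)`, `(x, y) ↦ (x/θ², y/θ³)`, `θ = √−2n`;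
  "`y ∈ E(K)⁻`" reads "`y` is in the image of the transfer" (`exists_transferE_eq_of_forall_gal`).
-/

noncomputable section

open scoped Classical

open WeierstrassCurve NumberField Literature.NumberTheory.EllipticCurves
  Literature.NumberTheory.EllipticCurves.TianYuanZhang2017 Literature.GroupTheory.FiniteAbelian

namespace Literature.NumberTheory.EllipticCurves.Tian2014

/-! ## §2 The data of Tian 2014 §2 / §4.2 (objects only; nothing asserted) -/

/-- **The objects of Tian 2014 §2 and §4.2 for `n ≡ 3 (mod 4)`** (`K = ℚ(√−2n)`): the number field `H` (= `H(i)`,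
Galois over `ℚ`), `i` and `ϖ = √−2n` in it, the Artin map `art : 𝒜 = Cl(K) → Aut(H/ℚ)` (`t ↦ σ_t`, the
identification of `𝒜` with `Gal(H(i)/K(i))`, p0022 L56–L57), the class `[ϖ′] = [𝔭₂]` (`piPrime`), the
involution `σ_{1+ϖ}` of `H(i)/H` (`tau`), complex conjugation (`conj`), and the CM points `z_t` (`z`).
[cite: Tian2014, Def. 2.7 (p0011 L25–L36), Thm. 2.8 (p0011 L37–L44), §4.2 (p0022 L47–L60)] -/
structure CMPointData (n : ℕ) : Type 1 where
  /-- the number field `H(i)` -/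
  H : Type
  [instField : Field H]
  [instNumberField : NumberField H]
  [instIsGalois : IsGalois ℚ H]
  /-- `i ∈ H(i)` -/
  im : H
  im_sq : im ^ 2 = -1
  /-- `ϖ = √−2n ∈ K ⊂ H(i)` -/
  sqrtNegTwoN : H
  sqrtNegTwoN_sq : sqrtNegTwoN ^ 2 = -((2 * n : ℕ) : H)
  /-- the Artin map `t ↦ σ_t` on ideal classes (`σ_t` fixing `i`) -/
  art : ClassGroup (𝓞 (GenusField (2 * n))) →* (H ≃ₐ[ℚ] H)
  /-- the class `[ϖ′]` of the uniformizer `ϖ′ = ϖ(1 + ϖ)` (= the prime above `2`) -/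
  piPrime : ClassGroup (𝓞 (GenusField (2 * n)))
  /-- `σ_{1+ϖ}`, the involution of `H(i)/H` -/
  tau : H ≃ₐ[ℚ] H
  /-- complex conjugation on `H(i)` -/
  conj : H ≃ₐ[ℚ] H
  /-- the CM points `z_t`, `t ∈ 𝒜` -/
  z : ClassGroup (𝓞 (GenusField (2 * n))) → EPoint H

attribute [instance] CMPointData.instField CMPointData.instNumberField CMPointData.instIsGalois

namespace CMPointData

variable {n : ℕ}

/-- `σ` acting on `E(H)` (the standard action `Affine.Point.map` of `σ ∈ Aut(H/ℚ)` on the `H`-points of the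
`ℚ`-curve `E`; additive). [cite: Tian2014, Def. 2.7 (p0011 L35–L36: z_t := z^{σ_t})] -/
def act (D : CMPointData n) (σ : D.H ≃ₐ[ℚ] D.H) : EPoint D.H →+ EPoint D.H :=
  WeierstrassCurve.Affine.Point.map σ.toAlgHom

/-! ## §3 The printed statements as predicates on the data -/

/-- **Thm. 2.8 (1)**: "the involution `σ_{1+ϖ}` of `Gal(H(i)/H)` maps `z_t` to `z_t + (0, 0)`".
[cite: Tian2014, Thm. 2.8 (1) (p0011 L39–L40)] -/
def thm28_1 (D : CMPointData n) : Prop :=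
  ∀ t, D.act D.tau (D.z t) = D.z t + ptZero

/-- **Thm. 2.8 (2)**: "the complex conjugation of `z_t` … is equal to `−z_{t⁻¹} + (1, 0)`".
[cite: Tian2014, Thm. 2.8 (2) (p0011 L41)] -/
def thm28_2 (D : CMPointData n) : Prop :=
  ∀ t, D.act D.conj (D.z t) = -D.z t⁻¹ + ptOne

/-- **Thm. 2.8 (3)**: "`z_{ϖ′t} − z_t = (1, 0)` or `(−1, 0)` according to `n ≡ 7 mod 8` or `3 mod 8`".
[cite: Tian2014, Thm. 2.8 (3) (p0011 L42–L44)] -/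
def thm28_3 (D : CMPointData n) : Prop :=
  ∀ t, D.z (D.piPrime * t) - D.z t = if n % 8 = 7 then ptOne else ptNegOne

/-- **(4.8)**: "`σ_s ∈ Gal(H(i)/K(i))` maps `y_{m,φ}` to `Σ_φ χ(t) z_{st}`", i.e. `z_t^{σ_s} = z_{st}` (with
`z_t := z^{σ_t}` of Def. 2.7 and `σ_s σ_t = σ_{st}`). [cite: Tian2014, (4.8) (p0023 L46–L50); Def. 2.7 (p0011 L35–L36)] -/
def eq48 (D : CMPointData n) : Prop :=
  ∀ s t, D.act (D.art s) (D.z t) = D.z (s * t)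

/-- **The Galois facts of §2 / §4.2 / Prop. 4.6** on `i`, `√−2n` and the generators: `σ_t` fixes `i` and `√−2n`
("`σ_t` fixing `i`", Def. 2.7; `𝒜 ≅ Gal(H(i)/K(i))`, p0022 L56–L57); `σ_{1+ϖ}` is "the involution of `H(i)/H`"
(moves `i`, fixes `√−2n ∈ H`, squares to the identity); complex conjugation moves `i` and `√−2n` and is an
involution; "`Gal(H(i)/ℚ)` is generated by `Gal(H(i)/K(i))`, the complex conjugation, and the operator
`σ_{1+ϖ}`" (p0023 L26–L28), and its subgroup `Gal(H(i)/K)` (the automorphisms fixing `√−2n`) is generated by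
`Gal(H(i)/K(i)) = {σ_t}` and `σ_{1+ϖ}` (`H(i) = H · K(i)` with `H ∩ K(i) = K`, "`i ∉ H`", p0022 L52–L53:
`Gal(H(i)/K) = Gal(H(i)/K(i)) × Gal(H(i)/H)`); `[ϖ′]` has order `2` in `𝒜` (`ϖ′` a uniformizer at the ramified prime `2`:
`[𝔭₂]² = [(2)] = 1`) and `[ϖ′] ≠ 1` (`x² + 2ny² = 2` has no solution for `n > 1`; Monsky p. 51: "`m` is
ambiguous", Thm. 5.5 proof "`m ∉ G²`"). [cite: Tian2014, Def. 2.7 (p0011 L35–L36), §4.2 (p0022 L52–L60), Prop. 4.6 proof (p0023 L26–L28)]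
[cite: Monsky1990MockHeegner, p. 51 and Thm. 5.5 proof (p. 62)] -/
def galoisFacts (D : CMPointData n) : Prop :=
  (∀ s, D.art s D.im = D.im ∧ D.art s D.sqrtNegTwoN = D.sqrtNegTwoN) ∧
  (D.tau D.im = -D.im ∧ D.tau D.sqrtNegTwoN = D.sqrtNegTwoN ∧ D.tau * D.tau = 1) ∧
  (D.conj D.im = -D.im ∧ D.conj D.sqrtNegTwoN = -D.sqrtNegTwoN ∧ D.conj * D.conj = 1) ∧
  (∀ σ : D.H ≃ₐ[ℚ] D.H, σ ∈ Subgroup.closure (Set.range D.art ∪ {D.tau, D.conj})) ∧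
  (∀ σ : D.H ≃ₐ[ℚ] D.H, σ D.sqrtNegTwoN = D.sqrtNegTwoN →
    σ ∈ Subgroup.closure (Set.range D.art ∪ {D.tau})) ∧
  (D.piPrime * D.piPrime = 1 ∧ D.piPrime ≠ 1)

/-- The conjunction of the displayed statements of Tian 2014 §2 / §4.2 for the data `D`.
[cite: Tian2014, Thm. 2.8 (p0011 L37–L44), (4.8) (p0023 L46–L50), Prop. 4.6 proof (p0023 L26–L28)] -/
def Printed (D : CMPointData n) : Prop :=
  D.thm28_1 ∧ D.thm28_2 ∧ D.thm28_3 ∧ D.eq48 ∧ D.galoisFacts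

/-! ## §4 Derived objects: the Heegner point `y_{2n,φ}` (4.5) and the transfer from `E_{2n}(ℚ)` -/

/-- "`φ ⊂ 𝒜` complete representatives of `𝒜/[ϖ′]`": every coset `{t, [ϖ′]t}` meets `φ` in exactly one element.
[cite: Tian2014, §4.2 (p0022 L84–L86)] -/
def IsRepsModPiPrime (D : CMPointData n) (φ : Finset (ClassGroup (𝓞 (GenusField (2 * n))))) : Prop :=
  ∀ t, Xor (t ∈ φ) (D.piPrime * t ∈ φ)

/-- **The Heegner point `y_{2n,φ} = Σ_{t∈φ} z_t`** ((4.5) with the trivial character `χ_{2n}`; Monsky's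
`S_{2D}` of Def. 4.4 in Tian's clothes: "`4y_{2n} = P_{χ₀}(f)`"). [cite: Tian2014, (4.5) (p0022 L84–L96)] -/
def yPoint (D : CMPointData n) (φ : Finset (ClassGroup (𝓞 (GenusField (2 * n))))) : EPoint D.H :=
  ∑ t ∈ φ, D.z t

/-- `√−2n ∈ H` squares to the image of `−2n ∈ ℚ` (plumbing for the transfer). [cite: Tian2014, Def. 2.7 (p0011 L25–L27: K = ℚ(√−2n))] [folklore] -/
theorem sqrtNegTwoN_sq' (D : CMPointData n) :
    D.sqrtNegTwoN ^ 2 = algebraMap ℚ D.H (-((2 * n : ℕ) : ℚ)) := by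
  rw [D.sqrtNegTwoN_sq, map_neg, map_natCast]

/-- `√−2n ≠ 0` for `n ≠ 0`. [cite: Tian2014, Def. 2.7 (p0011 L25–L27)] [folklore] -/
theorem sqrtNegTwoN_ne_zero (D : CMPointData n) (hn : n ≠ 0) : D.sqrtNegTwoN ≠ 0 := by
  intro h
  have h2 := D.sqrtNegTwoN_sq
  rw [h, zero_pow two_ne_zero, zero_eq_neg, Nat.cast_eq_zero] at h2
  omega

/-- **The transfer `E_{2n}(ℚ) →+ E(H(i))`** along `θ = √−2n`: "`E(ℚ(√−2n))⁻ ≅ E^{(2n)}(ℚ)`".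
[cite: Tian2014, Thm. 1.5 (p0003 L25–L27)] -/
def transfer (D : CMPointData n) (hn : n ≠ 0) :
    (congruentNumberCurve (2 * n)).toAffine.Point →+ EPoint D.H :=
  transferE (2 * n) D.sqrtNegTwoN D.sqrtNegTwoN_sq' (D.sqrtNegTwoN_ne_zero hn)

/-! ## §5 The two targets of the Monsky route on the data (nothing asserted) -/

/-- **M-y (KERNEL TARGET K1, the transplant — never a fact)**: for a set of representatives `φ`, the Heegner
point `y_{2n,φ}` is the transfer of a rational point `y′ ∈ E_{2n}(ℚ)` (Monsky Thm. 4.7: `S_N ∈ Λ_N` for `D`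
composite) with `y′ ∉ 2E_{2n}(ℚ) + E_{2n}(ℚ)_tor` (Monsky Thm. 5.5 for `n = p₅p₃`, Thm. 5.9 (1) for `n = p₅p₇`
with `(p₅/p₇) = −1`: "`S_{2D} ∉ 2Λ_{2D} + T`"). Printed for Monsky's `S_N`; for Tian's `y_{2n}` it is the
transplant of the printed PROOFS through the dictionary Thm. 2.8 (1)–(3) ↔ Thm. 2.11 (1)–(3) (Monsky p. 51).
[cite: Monsky1990MockHeegner, Thm. 4.7 (pp. 57–58), Thm. 5.5 (p. 62), Thm. 5.9 (1) (pp. 63–64), Thm. 5.14 (13)/(15) (p. 66)] -/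
def MinusY (D : CMPointData n) (hn : n ≠ 0) : Prop :=
  ∃ φ, D.IsRepsModPiPrime φ ∧ ∃ y' : (congruentNumberCurve (2 * n)).toAffine.Point,
    D.transfer hn y' = D.yPoint φ ∧
    ∀ z t : (congruentNumberCurve (2 * n)).toAffine.Point, IsOfFinAddOrder t → y' ≠ (2 : ℤ) • z + t

/-- **GZ (the explicit Gross–Zagier index relation on the data)**: integers `L`, `u` with `L² = 𝓛(2n)²`
(`IsScriptL (2n) L`, TYZ Thm. 1.2 = journal Thm. 1.4) and `u² = 𝓛(1)²`, `u` ODD (`IsScriptL 1 u`; TYZ Thm. 1.1 at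
`n = 1`: "The right-hand side is considered to be `1` if `n = 1`"), such that for every set of representatives
`φ`, every rational point `y′` transferring to `y_{2n,φ}` and every generator `g` of `E_{2n}(ℚ)/tor`,
`y′ − (±u·L)·g` is torsion — "`y_{2n} ≐ ±𝓛(1)𝓛(2n)·g`" (TYZ Thm. 3.3 at `(d₀, d₁) = (2n, 1)`:
`R_{χ₀} = ε·2^{h₂}·𝓛(1)·2⁻¹𝓛(2n)β`, `h₂(2n) = 2` for two odd primes; Tian `P_{χ₀}(f) = 4y_{2n}`; the (B4)
assembly `R_{χ₀} ≐ ±2y_{2n}`; equivalently, by heights, `ĥ(y) = 𝓛(1)²𝓛(2n)²ĥ(g)`, PROOF-A (9.1.4) + Lemma 8.1).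
The exact value `𝓛(1)² = 1` (`L(E,1)/Ω = 1/8`, PROOF-A §10) is NOT used: only `u` odd enters.
[cite: TianYuanZhang2017, Thm. 1.1 (p0002 L90–L99), Thm. 3.3 (chunk p0016 L48–L54), Lemma 3.14 (p0015 L51–L53)]
[cite: Tian2014, Thm. 1.5 (p0003 L19–L31), (4.5) = journal (4.6) (p0022 L84–L96), p0027 L62–L64, Prop. 2.1–2.2 (J124–J126)] -/
def GrossZagierScriptL (D : CMPointData n) (hn : n ≠ 0) : Prop :=
  ∃ L u : ℤ, IsScriptL (2 * n) L ∧ IsScriptL 1 u ∧ Odd u ∧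
    ∀ φ, D.IsRepsModPiPrime φ → ∀ y' : (congruentNumberCurve (2 * n)).toAffine.Point,
      D.transfer hn y' = D.yPoint φ →
      ∀ g : (congruentNumberCurve (2 * n)).toAffine.Point,
        (∀ w : (congruentNumberCurve (2 * n)).toAffine.Point, ∃ m : ℤ, IsOfFinAddOrder (w - m • g)) →
        ∃ s : ℤ, (s = 1 ∨ s = -1) ∧ IsOfFinAddOrder (y' - (s * u * L) • g)

end CMPointData

/-! ## §6 The named facts (nothing asserted; no `_holds` expected) -/

/-- **Tian 2014, Def. 2.7 / Thm. 2.8 / (4.8) / Prop. 4.6 (generation sentence), AS PRINTED, as ONE named fact**: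
for every square-free `n ≡ 3 (mod 4)` there are data `D : CMPointData n` (the field `H(i)`, `i`, `√−2n`, the
Artin map, `[ϖ′]`, `σ_{1+ϖ}`, complex conjugation, the CM points `z_t`) satisfying the displayed statements
`CMPointData.Printed`. Constructed in the source from the CM point `P = [(2 + i√2n)/8] ∈ X₀(32)`, the degree-`2`
parametrisation `f : X₀(32) → E` (Prop. 2.1–2.2) and Shimura reciprocity (Prop. 2.9, proof of Thm. 2.8).
THE SAME SYSTEM IS MONSKY 1990, Thm. 2.11 (1)–(3) AS PRINTED (p. 51; `D ≡ 3 (mod 4)` square-free, `ω = i√2D`,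
`K = ℚ(ω)`, `H` its Hilbert class field, the points `P_𝒜 ∈ C(H(i))` of Def. 2.9): "complex conjugation
`P_𝒜 ↦ (−1, 1) − P_{𝒜⁻¹}`; the involution of `H(i)/H`: `P_𝒜 ↦ P_𝒜 + (−1, −1)`; `σ ∈ G(H(i)/K(i))` with
`σ|H = σ_J`: `σ(P_𝒜) = P_{J⁻¹𝒜}`; `P_{m𝒜} − P_𝒜 = (1, −1)` or `(−1, 1)` as `D ≡ 3` or `7 (8)`" — through
Monsky's `ℚ`-isomorphism `φ : C ≅ E` (`(−1,1), (1,−1), (−1,−1) ↦ (1,0), (−1,0), (0,0)`, p. 62 Remarks (2)) and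
the relabelling `z_t := φ(P_{𝒜(t)⁻¹})`, `[ϖ′] := m`, Thm. 2.11 (1)–(3) ARE the displays `thm28_1`–`thm28_3`,
`eq48` (second read L2-38 C5: "the Galois skeletons agree on the nose"), so Monsky's points are a second
instance of `CMPointData n`. Monsky p. 51: "all we shall use are the properties of the `P_𝒜` given in Theorems
2.8 and 2.11" — the LICENCE under which the transplant (K1 = `MinusY`) uses nothing but `Printed`. One fact,
two printed sources; no `_holds` expected (CM points on `X₀(32)` / level-`8` modular functions, class field theory).
[cite: Tian2014, Def. 2.7, Thm. 2.8 (arXiv:1210.8231 p0011 L25–L44 = journal p. 132), Prop. 2.9 (p0011 L46–L60), (4.8) = journal (4.9) (p0023 L46–L50), Prop. 4.6 proof (p0023 L26–L28)]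
[cite: Monsky1990MockHeegner, Def. 2.9 and Thm. 2.11 (p. 51), Remarks (2) (p. 62)] -/
def thm28_cmPointSystem : Prop :=
  ∀ n : ℕ, Squarefree n → n % 4 = 3 → ∃ D : CMPointData n, D.Printed

/-! ## §7 Composition on ONE system: M-y ∧ GZ ∧ a generator ⟹ `𝓛(2n)` odd (plumbing; sorry-free) -/

namespace CMPointData

variable {n : ℕ}

/-- **`𝓛(2n)` is odd for a system with M-y and the Gross–Zagier index relation**, given a generator `g` of
`E_{2n}(ℚ)/tor`: if `L` were even, `y′ − (±uL)·g ∈ tor` would put `y′ ∈ 2E_{2n}(ℚ) + tor`, against M-y.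
[cite: Monsky1990MockHeegner, Lemma 3.3 (3) and the Remark after it (p. 53)] [cite: TianYuanZhang2017, Thm. 3.3] -/
theorem exists_odd_scriptL_of_minusY_of_grossZagier (D : CMPointData n) (hn : n ≠ 0)
    (hGZ : D.GrossZagierScriptL hn) (hMY : D.MinusY hn)
    (g : (congruentNumberCurve (2 * n)).toAffine.Point)
    (hg : ∀ w : (congruentNumberCurve (2 * n)).toAffine.Point, ∃ m : ℤ, IsOfFinAddOrder (w - m • g)) :
    ∃ L : ℤ, Odd L ∧ IsScriptL (2 * n) L := by
  obtain ⟨L, u, hL, -, hu, hrel⟩ := hGZ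
  obtain ⟨φ, hφ, y', hy', hnot⟩ := hMY
  refine ⟨L, ?_, hL⟩
  by_contra hodd
  obtain ⟨L', hL'⟩ := Int.not_odd_iff_even.mp hodd
  obtain ⟨s, -, ht⟩ := hrel φ hφ y' hy' g hg
  apply hnot ((s * u * L') • g) (y' - (s * u * L) • g) ht
  have h2 : (2 : ℤ) • ((s * u * L') • g) = (s * u * L) • g := by
    rw [← mul_zsmul, hL']; congr 1; ring
  rw [h2]; abel

end CMPointData


end Literature.NumberTheory.EllipticCurves.Tian2014

end
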